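import Mathlib
import Summits.QuantumFields.BalabanUV.T4Continuum.Support.NE3CombVsTowerPaths
import Summits.QuantumFields.BalabanUV.T4Continuum.Support.AveragingDeficitBlockDensity
import HarnessLib

/-!
# NE3 support, route (H♮) row K4-0 file 3: the one-level straightening and the one-step path mismatch

Continuation of `NE3CombVsTowerPaths` (row K4-0 of the owner's design; this lineage's SHAPE l.18587).  In the small-field class
of `W` at scale `L` (`IsUnitaryCfg W`, `SmallField W x`, `512(d+1)(d+4)L²x ≤ 1`):

§1 `norm_mul_sub_mul_le`, sizes (`l1_le_of_mem_periodBox`, `l1_natCast_smul`), the arithmetic `step_arith`;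
§2 THE ONE-LEVEL STRAIGHTENING: an averaged bond is within `4·loopRad d L x` of the straight `L`-segment
   (`norm_cavg_sub_hol_seg_le`: B7 (42) `V̄ = e^{X_c}V(c)` + the tree's `norm_expUnit_Xavg_sub_one_le`), hence along coarse
   segments, coarse tree words and coarse κ-last comb words of `cavg L W` versus their `L`-dilations in `W`
   (`norm_hol_cavg_seg_sub_le`, `norm_hol_cavg_tw_sub_le`, `norm_hol_cavg_klast_sub_le`: `≤ (|v|₁ + i)·4·loopRad`);
§3 THE ONE-STEP PATH MISMATCH (`norm_comb_step_sub_le`): «coarse κ-last comb of `cavg L W` up to the START of a coarse copy, then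
   fine tree·segment INCLUDING the own bond» versus «the fine κ-last comb of `W` to the same fine copy including its own bond»:
   `≤ (4d+5)·M·loopRad d L x` for coarse block side `M ≥ 1`, `L ≥ 2` — straightening `4(d+1)(M−1)·loopRad` + tree-vs-comb
   `(dL)²x` + merge `d(2d+1)L²(M−1)x`, with `L²x = loopRad∕(16(d+1)(d+4))`.  This is the top term of the numeric recursion of
   the END file (`(4d+5)·L^k·loopRad = ((4d+5)∕10)·(L^k·10·loopRad)`, the top term of this lineage's `DSum`).

HONEST: elementary estimates on OUR definitions; (P♮)_W, (ML_w) at W ≠ 1, T-E_w, NE3 are NOT proved here; spine 0∕9; finite T⁴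
rung (B)+1 — NOT infinite volume ∕ mass gap ∕ BetaPertH ∕ Clay.  PLACEMENT: `Summits/QuantumFields/BalabanUV/` (cell rule).
-/

set_option autoImplicit false

open scoped BigOperators Matrix.Norms.L2Operator
open Finset

namespace Summit.QuantumFields.BalabanUV.T4Continuum.NE3CombVsTowerStraighten

open Literature.MathematicalPhysics.QuantumFieldTheory.Balaban1983to89
open B7Prop1Explicit B7Prop2Explicit
open B8Lemma1NonAbelian (tw tw_nil tw_cons treeWord_eq_tw boxVec_nonneg)
open T4AveragingDeficitWall (IsUnitaryCfg SmallField)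
open T4AveragingDeficitWallBoundary (periodBox mem_periodBox)
open AveragingDeficitTransport (mem_U1_of_unitary)
open AveragingDeficitChartCalculus (cavg)
open AveragingDeficitBlockDensity (norm_expUnit_Xavg_sub_one_le cavg_mem)
open SpreadLift (loopRad)
open NE3CovariantLineAdjoint (klastWord)
open NE3CombVsTowerPaths (norm_hol_le_one sub_coord_nonneg l1_sub_coord seg_natCast_add norm_hol_treeWord_seg_sub_klast_le
  norm_hol_klast_mul_klast_sub_le)

noncomputable section

variable {d : ℕ} {n : Type*} [Fintype n] [DecidableEq n]

/-! ## §1 Bookkeeping and sizes -/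

/-- `‖AB − A′B′‖ ≤ ‖A − A′‖ + ‖B − B′‖` when `‖A′‖, ‖B‖ ≤ 1`. [folklore] -/
theorem norm_mul_sub_mul_le {A A' B B' : Matrix n n ℂ} (hA' : ‖A'‖ ≤ 1) (hB : ‖B‖ ≤ 1) :
    ‖A * B - A' * B'‖ ≤ ‖A - A'‖ + ‖B - B'‖ := by
  have h : A * B - A' * B' = (A - A') * B + A' * (B - B') := by noncomm_ring
  rw [h]
  calc ‖(A - A') * B + A' * (B - B')‖ ≤ ‖A - A'‖ * ‖B‖ + ‖A'‖ * ‖B - B'‖ :=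
        (norm_add_le _ _).trans (add_le_add (norm_mul_le _ _) (norm_mul_le _ _))
    _ ≤ ‖A - A'‖ * 1 + 1 * ‖B - B'‖ := by gcongr
    _ = ‖A - A'‖ + ‖B - B'‖ := by ring

/-- `|v|₁ ≤ d·(M − 1)` on `periodBox M`. [folklore] -/
theorem l1_le_of_mem_periodBox {M : ℕ} {v : Site d} (hv : v ∈ periodBox M) : (l1 v : ℝ) ≤ d * ((M : ℝ) - 1) := by
  rw [mem_periodBox] at hv
  have h : ∀ κ, ((v κ).natAbs : ℝ) ≤ (M : ℝ) - 1 := fun κ => by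
    obtain ⟨h0, hM⟩ := hv κ
    obtain ⟨m, hm⟩ := Int.eq_ofNat_of_zero_le h0
    rw [hm] at hM
    rw [hm, Int.natAbs_natCast]
    have h3 : (m : ℝ) + 1 ≤ (M : ℝ) := by exact_mod_cast (show (m : ℤ) + 1 ≤ (M : ℤ) by omega)
    linarith
  unfold l1
  push_cast
  calc ∑ κ : Fin d, ((v κ).natAbs : ℝ) ≤ ∑ _κ : Fin d, ((M : ℝ) - 1) := Finset.sum_le_sum fun κ _ => h κ
    _ = d * ((M : ℝ) - 1) := by rw [Finset.sum_const, Finset.card_univ, Fintype.card_fin]; ring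

/-- `|L•v|₁ = L·|v|₁`. [folklore] -/
theorem l1_natCast_smul (L : ℕ) (v : Site d) : l1 ((L : ℤ) • v) = L * l1 v := by
  unfold l1; rw [Finset.mul_sum]
  exact Finset.sum_congr rfl fun ι _ => by rw [Pi.smul_apply, smul_eq_mul, Int.natAbs_mul, Int.natAbs_natCast]

omit [Fintype n] [DecidableEq n] in
/-- The arithmetic of the one-step mismatch: `4(d+1)(M−1)ℓ + d²L²x + d(2d+1)L²(M−1)x ≤ (4d+5)Mℓ`, `ℓ = 16(d+1)(d+4)L²x`. [folklore] -/
theorem step_arith {D Lr M x : ℝ} (hD : 0 ≤ D) (hM : 1 ≤ M) (hx : 0 ≤ x) :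
    (D * (M - 1) + (M - 1)) * (4 * (16 * (D + 1) * (D + 4) * Lr ^ 2 * x)) + (D * Lr) * (D * Lr) * x
        + ((Lr * (D * (M - 1)) + Lr * (M - 1)) * (D * Lr) + (Lr * (D * (M - 1))) * (D * Lr)) * x
      ≤ (4 * D + 5) * M * (16 * (D + 1) * (D + 4) * Lr ^ 2 * x) := by
  set ℓ : ℝ := 16 * (D + 1) * (D + 4) * Lr ^ 2 * x with hℓ
  have hℓ0 : 0 ≤ ℓ := by positivity
  have hL2x : 0 ≤ Lr ^ 2 * x := by positivity
  have hB : (D * Lr) * (D * Lr) * x ≤ ℓ / 16 := by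
    have h1 : D * D ≤ (D + 1) * (D + 4) := by nlinarith
    have : (D * Lr) * (D * Lr) * x = (D * D) * (Lr ^ 2 * x) := by ring
    rw [this, hℓ]
    nlinarith [mul_le_mul_of_nonneg_right h1 hL2x]
  have hC : ((Lr * (D * (M - 1)) + Lr * (M - 1)) * (D * Lr) + (Lr * (D * (M - 1))) * (D * Lr)) * x ≤ (M - 1) * ℓ / 8 := by
    have h1 : D * (2 * D + 1) ≤ 2 * ((D + 1) * (D + 4)) := by nlinarith
    have hM1 : 0 ≤ M - 1 := by linarith
    have : ((Lr * (D * (M - 1)) + Lr * (M - 1)) * (D * Lr) + (Lr * (D * (M - 1))) * (D * Lr)) * x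
        = (D * (2 * D + 1)) * ((M - 1) * (Lr ^ 2 * x)) := by ring
    rw [this, hℓ]
    have h2 : 0 ≤ (M - 1) * (Lr ^ 2 * x) := mul_nonneg hM1 hL2x
    nlinarith [mul_le_mul_of_nonneg_right h1 h2]
  have hA : (D * (M - 1) + (M - 1)) * (4 * ℓ) = 4 * (D + 1) * (M - 1) * ℓ := by ring
  rw [hA]
  have hM1 : 0 ≤ M - 1 := by linarith
  nlinarith [mul_nonneg hM1 hℓ0, mul_nonneg hD hℓ0, mul_nonneg (mul_nonneg hD hM1) hℓ0]

/-! ## §2 The one-level straightening -/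

section Small

variable [Nonempty n] {L : ℕ} (hL : 1 ≤ L) {W : Site d → Fin d → (Matrix n n ℂ)ˣ} (hWu : IsUnitaryCfg W) {x : ℝ} (hx : 0 ≤ x)
  (h512 : 512 * (d + 1) * (d + 4) * (L : ℝ) ^ 2 * x ≤ 1) (hWx : SmallField W x)

include hL hWu hx h512 hWx

/-- **AN AVERAGED BOND IS WITHIN `4·loopRad` OF THE STRAIGHT `L`-SEGMENT**: `‖V̄(c) − W([Ly, Ly + Le_μ])‖ ≤ 4·loopRad d L x`
(B7 (42): `V̄ = e^{X_c}·V(c)` with `‖e^{X_c} − 1‖ ≤ 4·loopRad`). [cite: Balaban1985Averaging, (42) p.23] -/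
theorem norm_cavg_sub_hol_seg_le (y : Site d) (μ : Fin d) :
    ‖((cavg L W y μ : (Matrix n n ℂ)ˣ) : Matrix n n ℂ) - ((hol W ((L : ℤ) • y) (seg μ L) : (Matrix n n ℂ)ˣ) : Matrix n n ℂ)‖
      ≤ 4 * loopRad d L x := by
  have h : ((cavg L W y μ : (Matrix n n ℂ)ˣ) : Matrix n n ℂ)
      = ((expUnit (Xavg L W ((L : ℤ) • y) μ) : (Matrix n n ℂ)ˣ) : Matrix n n ℂ) * ((hol W ((L : ℤ) • y) (seg μ L) : (Matrix n n ℂ)ˣ) : Matrix n n ℂ) := by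
    simp only [cavg, bavg, Units.val_mul]
  rw [h, ← sub_one_mul]
  calc _ ≤ ‖((expUnit (Xavg L W ((L : ℤ) • y) μ) : (Matrix n n ℂ)ˣ) : Matrix n n ℂ) - 1‖ * ‖((hol W ((L : ℤ) • y) (seg μ L) : (Matrix n n ℂ)ˣ) : Matrix n n ℂ)‖ :=
        norm_mul_le _ _
    _ ≤ 4 * loopRad d L x * 1 :=
        mul_le_mul (norm_expUnit_Xavg_sub_one_le hL hWu hx h512 hWx y μ) (norm_hol_le_one hWu _ _) (norm_nonneg _)
          (by unfold loopRad; positivity)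
    _ = _ := mul_one _

/-- A coarse straight segment of `cavg L W` is within `m·4·loopRad` of the `L`-dilated fine segment of `W`. [folklore] -/
theorem norm_hol_cavg_seg_sub_le (κ : Fin d) : ∀ (m : ℕ) (y : Site d),
    ‖((hol (cavg L W) y (seg κ (m : ℤ)) : (Matrix n n ℂ)ˣ) : Matrix n n ℂ)
        - ((hol W ((L : ℤ) • y) (seg κ ((L * m : ℕ) : ℤ)) : (Matrix n n ℂ)ˣ) : Matrix n n ℂ)‖ ≤ (m : ℝ) * (4 * loopRad d L x) := by
  intro m
  induction m with
  | zero => intro y; simp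
  | succ m ih =>
      intro y
      have hc : hol (cavg L W) y (seg κ ((m + 1 : ℕ) : ℤ)) = hol (cavg L W) y (seg κ (m : ℤ)) * cavg L W (y + (m : ℤ) • e κ) κ := by
        rw [Nat.cast_succ, hol_seg_succ]
      have hf : hol W ((L : ℤ) • y) (seg κ ((L * (m + 1) : ℕ) : ℤ))
          = hol W ((L : ℤ) • y) (seg κ ((L * m : ℕ) : ℤ)) * hol W ((L : ℤ) • (y + (m : ℤ) • e κ)) (seg κ L) := by
        rw [show ((L * (m + 1) : ℕ) : ℤ) = ((L * m : ℕ) : ℤ) + ((L : ℕ) : ℤ) by push_cast; ring, seg_natCast_add, hol_append, disp_seg,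
          show (L : ℤ) • (y + (m : ℤ) • e κ) = (L : ℤ) • y + ((L * m : ℕ) : ℤ) • e κ by
            rw [smul_add, smul_smul]; push_cast; rfl]
      rw [hc, hf, Units.val_mul, Units.val_mul]
      calc _ ≤ _ + _ := norm_mul_sub_mul_le (norm_hol_le_one hWu _ _)
              (mem_U1_of_unitary (cavg_mem hL hWu hx h512 hWx _ _)).1
        _ ≤ (m : ℝ) * (4 * loopRad d L x) + 4 * loopRad d L x := add_le_add (ih y) (norm_cavg_sub_hol_seg_le hL hWu hx h512 hWx _ _)
        _ = ((m + 1 : ℕ) : ℝ) * (4 * loopRad d L x) := by push_cast; ring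

/-- A coarse tree word of `cavg L W` is within `|tw ks u|·4·loopRad` of the `L`-dilated fine tree word of `W` (`u ≥ 0`). [folklore] -/
theorem norm_hol_cavg_tw_sub_le : ∀ (ks : List (Fin d)) {u : Site d}, 0 ≤ u → ∀ (y : Site d),
    ‖((hol (cavg L W) y (tw ks u) : (Matrix n n ℂ)ˣ) : Matrix n n ℂ)
        - ((hol W ((L : ℤ) • y) (tw ks ((L : ℤ) • u)) : (Matrix n n ℂ)ˣ) : Matrix n n ℂ)‖ ≤ ((tw ks u).length : ℝ) * (4 * loopRad d L x) := by
  intro ks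
  induction ks with
  | nil => intro u _ y; simp
  | cons κ ks ih =>
      intro u hu y
      obtain ⟨m, hm⟩ := Int.eq_ofNat_of_zero_le (hu κ)
      have hc : hol (cavg L W) y (tw (κ :: ks) u) = hol (cavg L W) y (seg κ (m : ℤ)) * hol (cavg L W) (y + (m : ℤ) • e κ) (tw ks u) := by
        rw [tw_cons, hm, hol_append, disp_seg]
      have hf : hol W ((L : ℤ) • y) (tw (κ :: ks) ((L : ℤ) • u))
          = hol W ((L : ℤ) • y) (seg κ ((L * m : ℕ) : ℤ)) * hol W ((L : ℤ) • (y + (m : ℤ) • e κ)) (tw ks ((L : ℤ) • u)) := by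
        rw [tw_cons, Pi.smul_apply, hm, smul_eq_mul, show (L : ℤ) * (m : ℤ) = ((L * m : ℕ) : ℤ) by push_cast; ring, hol_append, disp_seg,
          show (L : ℤ) • (y + (m : ℤ) • e κ) = (L : ℤ) • y + ((L * m : ℕ) : ℤ) • e κ by rw [smul_add, smul_smul]; push_cast; rfl]
      rw [hc, hf, Units.val_mul, Units.val_mul]
      have hcu : IsUnitaryCfg (cavg L W) := fun y' μ' => cavg_mem hL hWu hx h512 hWx y' μ'
      calc _ ≤ _ + _ := norm_mul_sub_mul_le (norm_hol_le_one hWu _ _) (norm_hol_le_one hcu _ _)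
        _ ≤ (m : ℝ) * (4 * loopRad d L x) + ((tw ks u).length : ℝ) * (4 * loopRad d L x) :=
            add_le_add (norm_hol_cavg_seg_sub_le hL hWu hx h512 hWx κ m y) (ih hu _)
        _ = ((tw (κ :: ks) u).length : ℝ) * (4 * loopRad d L x) := by
            rw [tw_cons, List.length_append, length_seg, hm, Int.natAbs_natCast]; push_cast; ring

/-- **A COARSE COMB WORD OF `cavg L W` IS WITHIN `(|v|₁ + i)·4·loopRad` OF THE `L`-DILATED COMB WORD OF `W`** (`v ≥ 0`):
`‖V̄(klast_κ v i from y) − W(klast_κ (L•v) (L·i) from L•y)‖ ≤ (|v|₁ + i)·4·loopRad d L x`. [folklore] -/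
theorem norm_hol_cavg_klast_sub_le (y : Site d) (κ : Fin d) {v : Site d} (hv : 0 ≤ v) (i : ℕ) :
    ‖((hol (cavg L W) y (klastWord κ v i) : (Matrix n n ℂ)ˣ) : Matrix n n ℂ)
        - ((hol W ((L : ℤ) • y) (klastWord κ ((L : ℤ) • v) (L * i)) : (Matrix n n ℂ)ˣ) : Matrix n n ℂ)‖
      ≤ ((l1 v : ℝ) + i) * (4 * loopRad d L x) := by
  obtain ⟨m, hm⟩ := Int.eq_ofNat_of_zero_le (hv κ)
  set v' : Site d := v - v κ • e κ with hv'
  have hv'0 : 0 ≤ v' := sub_coord_nonneg hv κ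
  have hLv : (L : ℤ) • v - ((L : ℤ) • v) κ • e κ = (L : ℤ) • v' := by
    simp only [hv', Pi.smul_apply, smul_eq_mul, smul_sub, smul_smul]
  have hc : hol (cavg L W) y (klastWord κ v i) = hol (cavg L W) y (treeWord v') * hol (cavg L W) (y + v') (seg κ ((m + i : ℕ) : ℤ)) := by
    rw [klastWord, ← hv', hol_append, disp_treeWord, hm]; push_cast; rfl
  have hf : hol W ((L : ℤ) • y) (klastWord κ ((L : ℤ) • v) (L * i))
      = hol W ((L : ℤ) • y) (treeWord ((L : ℤ) • v')) * hol W ((L : ℤ) • (y + v')) (seg κ ((L * (m + i) : ℕ) : ℤ)) := by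
    rw [klastWord, hLv, hol_append, disp_treeWord, smul_add, Pi.smul_apply, hm, smul_eq_mul]; push_cast; ring_nf
  rw [hc, hf, Units.val_mul, Units.val_mul]
  have hcu : IsUnitaryCfg (cavg L W) := fun y' μ' => cavg_mem hL hWu hx h512 hWx y' μ'
  have hl1 : (l1 v' : ℝ) + m = l1 v := by
    have h := l1_sub_coord v κ; rw [← hv', hm, Int.natAbs_natCast] at h; exact_mod_cast h
  calc _ ≤ _ + _ := norm_mul_sub_mul_le (norm_hol_le_one hWu _ _) (norm_hol_le_one hcu _ _)
    _ ≤ ((tw (List.finRange d).reverse v').length : ℝ) * (4 * loopRad d L x) + ((m + i : ℕ) : ℝ) * (4 * loopRad d L x) :=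
        add_le_add (norm_hol_cavg_tw_sub_le hL hWu hx h512 hWx _ hv'0 _) (norm_hol_cavg_seg_sub_le hL hWu hx h512 hWx κ _ _)
    _ = ((l1 v : ℝ) + i) * (4 * loopRad d L x) := by
        rw [← treeWord_eq_tw, length_treeWord, ← hl1]; push_cast; ring

/-! ## §3 The one-step path mismatch -/

omit hL in
/-- **THE ONE-STEP PATH MISMATCH** (`L ≥ 2`, coarse block side `M ≥ 1`, small-field class of `W` at scale `L`): for a coarse copy
`(y + v₁ + i₁e_κ, κ)` of the block at `y` (`v₁ ∈ [0,M)^d`, `i₁ < M`) and a fine copy `(L•(y+v₁+i₁e_κ) + r + i′e_κ, κ)` of its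
`L`-block (`i′ < L`), the nested transport «coarse κ-last comb of `V̄ = cavg L W` up to the START of the coarse copy, then fine
tree·segment INCLUDING the own bond» is within `(4d+5)·M·loopRad d L x` of the fine κ-last comb of `W` from `L•y` to the same
fine copy including its own bond:
straightening `(|v₁|₁+i₁)·4·loopRad ≤ 4(d+1)(M−1)·loopRad` (§3) + tree-vs-comb `(d(L−1))²x` + merge `d(2d+1)L(L−1)(M−1)·x` (§2),
and `L²x = loopRad∕(16(d+1)(d+4))`. [folklore] -/
theorem norm_comb_step_sub_le (hL2 : 2 ≤ L) {M : ℕ} (hM : 1 ≤ M) (y : Site d) (κ : Fin d) {v₁ : Site d} (hv₁ : v₁ ∈ periodBox M)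
    {i₁ : ℕ} (hi₁ : i₁ < M) (r : Fin d → Fin L) (i' : ℕ) :
    ‖((hol (cavg L W) y (klastWord κ v₁ i₁)
          * hol W ((L : ℤ) • (y + v₁ + (i₁ : ℤ) • e κ)) (treeWord (boxVec L r) ++ seg κ ((i' + 1 : ℕ) : ℤ)) : (Matrix n n ℂ)ˣ) : Matrix n n ℂ)
        - ((hol W ((L : ℤ) • y) (klastWord κ ((L : ℤ) • v₁ + boxVec L r) (L * i₁ + i' + 1)) : (Matrix n n ℂ)ˣ) : Matrix n n ℂ)‖
      ≤ (4 * d + 5) * M * loopRad d L x := by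
  have hL : 1 ≤ L := le_trans (by norm_num) hL2
  have hv₁0 : 0 ≤ v₁ := fun ι => ((mem_periodBox.mp hv₁) ι).1
  have hr0 : 0 ≤ boxVec L r := boxVec_nonneg L r
  have hLv0 : 0 ≤ (L : ℤ) • v₁ := fun ι => by simp only [Pi.smul_apply, smul_eq_mul]; exact mul_nonneg (by positivity) (hv₁0 ι)
  have hcu : IsUnitaryCfg (cavg L W) := fun y' μ' => cavg_mem hL hWu hx h512 hWx y' μ'
  -- the three moves
  have hS1 := norm_hol_cavg_klast_sub_le hL hWu hx h512 hWx y κ hv₁0 i₁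
  have hS2 := norm_hol_treeWord_seg_sub_klast_le hWu hx hWx ((L : ℤ) • (y + v₁ + (i₁ : ℤ) • e κ)) κ hr0 (i' + 1)
  have hS3 := norm_hol_klast_mul_klast_sub_le hWu hx hWx ((L : ℤ) • y) κ hLv0 hr0 (L * i₁) (i' + 1)
  rw [show L * i₁ + (i' + 1) = L * i₁ + i' + 1 from rfl] at hS3
  have hpos : (L : ℤ) • y + (L : ℤ) • v₁ + ((L * i₁ : ℕ) : ℤ) • e κ = (L : ℤ) • (y + v₁ + (i₁ : ℤ) • e κ) := by
    rw [smul_add, smul_add, smul_smul]; push_cast; rfl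
  rw [hpos] at hS3
  -- sizes
  have hl1v : (l1 v₁ : ℝ) ≤ d * ((M : ℝ) - 1) := l1_le_of_mem_periodBox hv₁
  have hl1r : (l1 (boxVec L r) : ℝ) ≤ d * (L : ℝ) := by exact_mod_cast l1_boxVec_le (L := L) r
  have hl1L : (l1 ((L : ℤ) • v₁) : ℝ) = L * l1 v₁ := by exact_mod_cast l1_natCast_smul L v₁
  have hi₁' : (i₁ : ℝ) ≤ (M : ℝ) - 1 := by
    have : (i₁ : ℝ) + 1 ≤ M := by exact_mod_cast hi₁
    linarith
  have hM1 : (1 : ℝ) ≤ M := by exact_mod_cast hM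
  have hM0 : (0 : ℝ) ≤ (M : ℝ) - 1 := by linarith
  have hd0 : (0 : ℝ) ≤ d := Nat.cast_nonneg d
  have hL0 : (0 : ℝ) ≤ L := Nat.cast_nonneg L
  have hℓ : loopRad d L x = 16 * ((d : ℝ) + 1) * ((d : ℝ) + 4) * (L : ℝ) ^ 2 * x := by unfold loopRad; ring
  have hℓ0 : 0 ≤ 4 * loopRad d L x := by unfold loopRad; positivity
  have hl1v0 : (0 : ℝ) ≤ l1 v₁ := Nat.cast_nonneg _
  have hl1r0 : (0 : ℝ) ≤ l1 (boxVec L r) := Nat.cast_nonneg _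
  -- the three bounds with sizes inserted
  have hB1 : ((l1 v₁ : ℝ) + i₁) * (4 * loopRad d L x) ≤ (d * ((M : ℝ) - 1) + ((M : ℝ) - 1)) * (4 * loopRad d L x) :=
    mul_le_mul_of_nonneg_right (add_le_add hl1v hi₁') hℓ0
  have hB2 : (l1 (boxVec L r) : ℝ) * (l1 (boxVec L r) : ℝ) * x ≤ (d * (L : ℝ)) * (d * (L : ℝ)) * x :=
    mul_le_mul_of_nonneg_right (mul_le_mul hl1r hl1r hl1r0 (by positivity)) hx
  have hB3 : (((l1 ((L : ℤ) • v₁) : ℝ) + (L * i₁ : ℕ)) * (l1 (boxVec L r) : ℝ) + (l1 ((L : ℤ) • v₁) : ℝ) * (l1 (boxVec L r) : ℝ)) * x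
      ≤ (((L : ℝ) * (d * ((M : ℝ) - 1)) + L * ((M : ℝ) - 1)) * (d * (L : ℝ)) + ((L : ℝ) * (d * ((M : ℝ) - 1))) * (d * (L : ℝ))) * x := by
    rw [hl1L]; push_cast
    have h1 : (L : ℝ) * l1 v₁ ≤ L * (d * ((M : ℝ) - 1)) := mul_le_mul_of_nonneg_left hl1v hL0
    have h2 : (L : ℝ) * i₁ ≤ L * ((M : ℝ) - 1) := mul_le_mul_of_nonneg_left hi₁' hL0
    refine mul_le_mul_of_nonneg_right (add_le_add (mul_le_mul (add_le_add h1 h2) hl1r hl1r0 (by positivity))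
      (mul_le_mul h1 hl1r hl1r0 (by positivity))) hx
  have hfin := step_arith (Lr := (L : ℝ)) hd0 hM1 hx
  rw [← hℓ] at hfin
  -- chain
  calc _ ≤ ‖((hol (cavg L W) y (klastWord κ v₁ i₁)
              * hol W ((L : ℤ) • (y + v₁ + (i₁ : ℤ) • e κ)) (treeWord (boxVec L r) ++ seg κ ((i' + 1 : ℕ) : ℤ)) : (Matrix n n ℂ)ˣ) : Matrix n n ℂ)
            - ((hol W ((L : ℤ) • y) (klastWord κ ((L : ℤ) • v₁) (L * i₁))
              * hol W ((L : ℤ) • (y + v₁ + (i₁ : ℤ) • e κ)) (klastWord κ (boxVec L r) (i' + 1)) : (Matrix n n ℂ)ˣ) : Matrix n n ℂ)‖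
          + ‖((hol W ((L : ℤ) • y) (klastWord κ ((L : ℤ) • v₁) (L * i₁))
              * hol W ((L : ℤ) • (y + v₁ + (i₁ : ℤ) • e κ)) (klastWord κ (boxVec L r) (i' + 1)) : (Matrix n n ℂ)ˣ) : Matrix n n ℂ)
            - ((hol W ((L : ℤ) • y) (klastWord κ ((L : ℤ) • v₁ + boxVec L r) (L * i₁ + i' + 1)) : (Matrix n n ℂ)ˣ) : Matrix n n ℂ)‖ :=
        norm_sub_le_norm_sub_add_norm_sub _ _ _
    _ ≤ (((l1 v₁ : ℝ) + i₁) * (4 * loopRad d L x) + (l1 (boxVec L r) : ℝ) * (l1 (boxVec L r) : ℝ) * x)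
          + (((l1 ((L : ℤ) • v₁) : ℝ) + (L * i₁ : ℕ)) * (l1 (boxVec L r) : ℝ) + (l1 ((L : ℤ) • v₁) : ℝ) * (l1 (boxVec L r) : ℝ)) * x := by
        refine add_le_add ?_ hS3
        rw [Units.val_mul, Units.val_mul]
        exact (norm_mul_sub_mul_le (norm_hol_le_one hWu _ _) (norm_hol_le_one hWu _ _)).trans (add_le_add hS1 hS2)
    _ ≤ (4 * d + 5) * M * loopRad d L x := by linarith [hB1, hB2, hB3, hfin]

end Small

end

end Summit.QuantumFields.BalabanUV.T4Continuum.NE3CombVsTowerStraighten
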